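import Literature.MathematicalPhysics.QuantumLattice.AnisotropicHeisenbergInfraredBound
import Literature.MathematicalPhysics.QuantumLattice.XYZGroundStateOrderCorrIneq
import HarnessLib

/-!
# Energetic comparison lemmas for the Heisenberg antiferromagnet with direction-dependent
# couplings — Kennedy–Lieb–Shastry's "`0 ≤ ρ₃ ≤ ρ₁`", the Néel bound and `e'₀ = 2ρ₁ + rρ₃`

Topic `MathematicalPhysics/QuantumLattice`; companion of `AnisotropicHeisenbergInfraredBound.lean`
(the direction-resolved infrared bound) and of `HeisenbergOrderNeelProofs.lean` (the isotropic
Néel variational bound (N)). No named fact is introduced; everything here is a theorem.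

## What is printed

Kennedy, Lieb and Shastry, J. Stat. Phys. **53** (1988) 1019–1030, p. 1026, for the model (5)
(`J = 1, 1, r`): "The double commutator (13) equals `(2/3)[(2 - cos q₁ - cos q₂)ρ₁ + r(1 - cos q₃)ρ₃]`
where `ρ₁` and `ρ₃` are the expectations of `𝐒_x·𝐒_y` for bonds `{xy}` in the first and third
lattice directions, respectively. We will show that `0 ≤ ρ₃ ≤ ρ₁`. This fact, together with
`e'₀ = 2ρ₁ + rρ₃`, implies that the double commutator is bounded above by `e'₀ E'_q/3`. This, in
turn, implies (6). First of all, `ρ₃ ≥ 0`, for if `ρ₃ < 0`, we would have that `-e'₀ > 2ρ₁ = ⟨H¹ + H²⟩`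
… We could then lower the energy, `-e'₀`, by replacing the ground state `φ₀` by the ground state
for `H¹ + H²` … Now suppose that `ρ₃ > ρ₁` and assume that the lattice is cubic … Then we can simply
rotate the lattice about the 1 axis so that directions 2 and 3 are interchanged. The energy would
then be `-ρ₁ - rρ₁ - ρ₃`, which cannot be less than `-e'₀ = -2ρ₁ - rρ₃`. Thus, `ρ₃ ≤ ρ₁`."
P. 1023: "several values of `e₀` ranging from the Néel bound of `(2+r)/4` to the Anderson bound".

In the tree's sign convention `εᵢ = |Λ|⁻¹ Σ_z ⟨S¹_z S¹_{z+eᵢ}⟩ = -ρᵢ/3` (`heisAnisoDirBondCorr`),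
this file proves, for every `d`, every spin `S = n/2`, every coupling vector `K` and every even
torus of side `2k ≥ 4` (the "cubic lattice" hypothesis of the rotation argument):

* **(X) the axis-exchange inequality** `(K_a - K_b)(ε_a - ε_b) ≤ 0` (`sub_mul_sub_dirBondCorr_nonpos`)
  — KLS's rotation argument verbatim (the relabelled ground state as a trial state), of which
  "`ρ₃ ≤ ρ₁` for `r ≤ 1`" is the case `K = (1, 1, r)`; and **(S)** `K_a = K_b ⇒ ε_a = ε_b`;
* **(P) the sign** `Kᵢ εᵢ ≤ 0` (`mul_heisAnisoDirBondCorr_nonpos`; "`ρ₃ ≥ 0`") — proved here by a shorter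
  road than the printed product-state argument: the three rotations by `π` about the spin axes on
  the odd hyperplanes `{xᵢ odd}` are symmetries of every bond except the `i`-bonds, on which they
  sum to `-𝐒_x·𝐒_y`; hence `H_K + Σ_a W_a H_K W_a⁻¹ = 4 H_{K, Kᵢ := 0}`, so
  `E₀(H_K) ≤ E₀(H_{K, Kᵢ := 0}) ≤ ω_K(H_{K, Kᵢ := 0}) = E₀(H_K) - 3|Λ| Kᵢ εᵢ` (superadditivity of
  the ground-state energy and the variational principle) — the printed conclusion, no tensor
  product of planar ground states needed;
* **(N) the Néel bound** `Σᵢ Kᵢ εᵢ ≤ -(S²/3) Σᵢ Kᵢ` (`sum_mul_heisAnisoDirBondCorr_le_neel`; for `S = ½`,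
  `K = (1,1,r)`: `e₀ ≥ (2+r)/4`);
* **(T)** `|εᵢ| ≤ S²`;
* the packaging for the infrared bound: for the direction `i₀` of a largest coupling,
  `-εᵢ ≤ -ε_{i₀}` for all `i` (`neg_heisAnisoDirBondCorr_le_of_isMax`), whence with
  `heisAniso_infraredBound_ground`: `ĝ_q² E^K_{q-Q} ≤ ½(-ε_{i₀}) E^K_q` — KLS's (6)–(7) with
  `e₀/12` replaced by `ρ_{max}/12·…`, i.e. before the last step `ρ₁ ≤ e₀/2`
  (`heisAniso_infraredBound_max`).

## References

* [KLS1988JSP] T. Kennedy, E. H. Lieb, B. S. Shastry, J. Stat. Phys. 53 (1988) 1019–1030,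
  pp. 1023 and 1026 (read in: E. H. Lieb, *Statistical Mechanics (Selecta)*, paper IV.7).
* [DysonLiebSimon1978] F. J. Dyson, E. H. Lieb, B. Simon, J. Stat. Phys. 18 (1978) 335–383,
  App. C (the Néel state as a trial state).
-/

noncomputable section

open Matrix Finset Filter Topology
open scoped ComplexOrder
open Literature.MathematicalPhysics.QuantumLattice Literature.MathematicalPhysics.QuantumLattice.SpinOperators
  Literature.Probability.LatticeModels

namespace Literature.MathematicalPhysics.QuantumLattice

variable {d : ℕ}

/-! ### Superadditivity of the ground-state energy -/

/-- **Superadditivity of the ground-state energy** (the variational principle twice in the ground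
state of `A + B`): `E₀(A) + E₀(B) ≤ E₀(A + B)` for Hermitian matrices — the form in which
"the energy could be lowered" comparisons of sums of Hamiltonians are made
([KLS1988JSP] p. 1026; Anderson's argument, [DysonLiebSimon1978] App. C). [cite: KLS1988JSP, p. 1026] -/
theorem Matrix.groundEnergy_add_groundEnergy_le {m : Type*} [Fintype m] [DecidableEq m] [Nonempty m]
    {A B : Matrix m m ℂ} (hA : A.IsHermitian) (hB : B.IsHermitian) :
    A.groundEnergy + B.groundEnergy ≤ (A + B).groundEnergy := by
  have h1 := groundEnergy_le_groundStateFunctional_re (hA.add hB) hA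
  have h2 := groundEnergy_le_groundStateFunctional_re (hA.add hB) hB
  have h3 := congrArg Complex.re (groundStateFunctional_hamiltonian (hA.add hB))
  rw [Complex.ofReal_re, map_add, Complex.add_re] at h3
  linarith

/-! ### (T) and the relabelled observables -/

section Observables

variable (L : ℕ) [NeZero L] (n : ℕ) (K : Fin d → ℝ)

/-- **(T)** `|εᵢ| ≤ S²` for the direction-resolved bond correlation (average of `|G(x, x+eᵢ)| ≤ S²`).
[cite: KLS1988JSP, p. 1026] -/
theorem heisAnisoDirBondCorr_abs_le (α : Fin 3) (i : Fin d) :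
    |heisAnisoDirBondCorr α L n K i| ≤ ((n : ℝ) / 2) ^ 2 := by
  have hLd : (0 : ℝ) < (L : ℝ) ^ d := by
    have : (0 : ℝ) < L := by exact_mod_cast Nat.pos_of_ne_zero (NeZero.ne L)
    positivity
  have hcard : (Fintype.card (TorusSite d L) : ℝ) = (L : ℝ) ^ d := by
    rw [Fintype.card_pi, prod_const, ZMod.card, card_univ, Fintype.card_fin]
    push_cast
    ring
  rw [heisAnisoDirBondCorr_of_neZero, abs_div, abs_of_pos hLd, div_le_iff₀ hLd]
  calc |∑ x : TorusSite d L, heisAnisoGroundCorr α L n K x (x + Pi.single i 1)|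
      ≤ ∑ x : TorusSite d L, |heisAnisoGroundCorr α L n K x (x + Pi.single i 1)| :=
        abs_sum_le_sum_abs _ _
    _ ≤ ∑ _x : TorusSite d L, ((n : ℝ) / 2) ^ 2 :=
        sum_le_sum fun x _ => heisAnisoGroundCorr_abs_le L n K α x _
    _ = ((n : ℝ) / 2) ^ 2 * (L : ℝ) ^ d := by rw [sum_const, card_univ, nsmul_eq_mul, hcard, mul_comm]

end Observables

/-! ### (X), (S): permutations of the coordinate axes -/

section AxisPermutation

variable (L : ℕ) [NeZero L] (n : ℕ)

/-- The coupling weight of a relabelled bond: `w_K({x∘s, y∘s}) = w_{K∘s⁻¹}({x, y})`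
(`(x + eᵢ)∘s = x∘s + e_{s⁻¹ i}`). [cite: KLS1988JSP, p. 1026] -/
theorem dirCoupling_map_comp_perm (hL3 : 3 ≤ L) (K : Fin d → ℝ) (s : Equiv.Perm (Fin d))
    {e : Sym2 (TorusSite d L)} (he : e ∈ (torusGraph d L).edgeFinset) :
    dirCoupling L K (Sym2.map (fun x : TorusSite d L => (x ∘ s : TorusSite d L)) e) =
      dirCoupling L (K ∘ s.symm) e := by
  revert he
  induction e using Sym2.ind with
  | h x y =>
    intro he
    rw [SimpleGraph.mem_edgeFinset, SimpleGraph.mem_edgeSet, torusGraph_adj_iff] at he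
    obtain ⟨-, ⟨i, hi⟩ | ⟨i, hi⟩⟩ := he
    · rw [Sym2.map_mk, dirCoupling_mk_of_eq_add L hL3 (K ∘ s.symm) hi, hi, add_single_comp_perm,
        dirCoupling_mk_add_single L hL3]
      rfl
    · rw [Sym2.eq_swap, Sym2.map_mk, Sym2.eq_swap, dirCoupling_mk_of_eq_add L hL3 (K ∘ s.symm) hi,
        hi, add_single_comp_perm, Sym2.eq_swap, dirCoupling_mk_add_single L hL3]
      rfl

/-- **Relabelling the axes maps `H_K` to `H_{K∘s}`**: on tensor indices `σ ↦ σ ∘ π`, `π x = x ∘ s`,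
`(H_K) ∘ (π × π) = H_{K∘s}` ([KLS1988JSP] p. 1026: "rotate the lattice about the 1 axis so that
directions 2 and 3 are interchanged"). [cite: KLS1988JSP, p. 1026] -/
theorem heisAnisoTorus_submatrix_comp_perm (hL3 : 3 ≤ L) (K : Fin d → ℝ) (s : Equiv.Perm (Fin d)) :
    (heisAnisoTorus L n K).submatrix
        (fun σ : TensorIndex (TorusSite d L) (n + 1) =>
          σ ∘ (Equiv.arrowCongr s.symm (Equiv.refl (ZMod L))))
        (fun σ => σ ∘ (Equiv.arrowCongr s.symm (Equiv.refl (ZMod L)))) =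
      heisAnisoTorus L n (K ∘ s) := by
  set π : TorusSite d L ≃ TorusSite d L := Equiv.arrowCongr s.symm (Equiv.refl (ZMod L)) with hπ
  rw [heisAnisoTorus, heisAnisoTorus, heisWeightedHamiltonian, heisWeightedHamiltonian,
    submatrix_finset_sum]
  refine Finset.sum_nbij' (Sym2.map π) (Sym2.map π.symm) (fun e he => ?_) (fun e he => ?_)
    (fun e _ => ?_) (fun e _ => ?_) (fun e he => ?_)
  · exact (map_comp_perm_mem_edgeFinset L s e).2 he
  · exact (map_comp_perm_mem_edgeFinset L s.symm e).2 he
  · simp only [Sym2.map_map, Equiv.symm_comp_self, Sym2.map_id', id_eq]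
  · simp only [Sym2.map_map, Equiv.self_comp_symm, Sym2.map_id', id_eq]
  · have hw : dirCoupling L (K ∘ s) (Sym2.map π e) = dirCoupling L K e := by
      have h := dirCoupling_map_comp_perm L hL3 (K ∘ s) s (mem_coe.1 he)
      rw [show (K ∘ s) ∘ s.symm = K by ext i; simp] at h
      exact h
    rw [hw]
    induction e using Sym2.ind with
    | h x y =>
      simp only [Sym2.map_mk, spinDotSym_mk, spinDot, submatrix_finset_sum, submatrix_smul,
        Pi.smul_apply, spinBond_submatrix_comp]

/-- The tracial ground state is covariant under a relabelling of the index set: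
`ω_{A∘(e×e)}(O∘(e×e)) = ω_A(O)` (conjugation by the permutation unitary of `e`).
[cite: KLS1988JSP, p. 1026] -/
theorem Matrix.groundStateFunctional_submatrix_equiv {m : Type*} [Fintype m] [DecidableEq m]
    (A O : Matrix m m ℂ) (e : m ≃ m) :
    (A.submatrix e e).groundStateFunctional (O.submatrix e e) = A.groundStateFunctional O := by
  have hUU' : (e.toPEquiv.toMatrix : Matrix m m ℂ)ᴴ * e.toPEquiv.toMatrix = 1 :=
    conjTranspose_toPEquiv_toMatrix_mul_self e
  have hUU : (e.toPEquiv.toMatrix : Matrix m m ℂ) * (e.toPEquiv.toMatrix)ᴴ = 1 := by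
    have h := conjTranspose_toPEquiv_toMatrix_mul_self (m := m) e.symm
    rw [conjTranspose_toPEquiv_toMatrix, Equiv.symm_symm] at h
    rw [conjTranspose_toPEquiv_toMatrix]
    exact h
  rw [← toPEquiv_toMatrix_conj e A, ← toPEquiv_toMatrix_conj e O]
  exact Matrix.groundStateFunctional_unitary_conj hUU hUU' O

/-- **Covariance of the two-point function under relabelling of the axes**:
`G^α_{K∘s}(x∘s, y∘s) = G^α_K(x, y)` (the tracial ground state of the relabelled Hamiltonian is the
relabelled ground state). [cite: KLS1988JSP, p. 1026] -/
theorem heisAnisoGroundCorr_comp_perm (hL3 : 3 ≤ L) (K : Fin d → ℝ) (s : Equiv.Perm (Fin d))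
    (α : Fin 3) (x y : TorusSite d L) :
    heisAnisoGroundCorr α L n (K ∘ s) (x ∘ s) (y ∘ s) = heisAnisoGroundCorr α L n K x y := by
  set π : TorusSite d L ≃ TorusSite d L := Equiv.arrowCongr s.symm (Equiv.refl (ZMod L)) with hπ
  have hH : (heisAnisoTorus L n K).submatrix (fun σ => σ ∘ π) (fun σ => σ ∘ π) =
      heisAnisoTorus L n (K ∘ s) :=
    heisAnisoTorus_submatrix_comp_perm L n hL3 K s
  have hO : (siteSpin n x α * siteSpin n y α).submatrix (fun σ => σ ∘ π) (fun σ => σ ∘ π) =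
      siteSpin n (x ∘ s) α * siteSpin n (y ∘ s) α := by
    rw [Matrix.submatrix_mul _ _ _ _ _ (bijective_comp_equiv (q := n + 1) π),
      siteSpin_submatrix_comp, siteSpin_submatrix_comp]
    rfl
  have key : ((heisAnisoTorus L n K).submatrix (fun σ => σ ∘ π) (fun σ => σ ∘ π)).groundStateFunctional
      ((siteSpin n x α * siteSpin n y α).submatrix (fun σ => σ ∘ π) (fun σ => σ ∘ π)) =
      (heisAnisoTorus L n K).groundStateFunctional (siteSpin n x α * siteSpin n y α) :=
    Matrix.groundStateFunctional_submatrix_equiv (heisAnisoTorus L n K)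
      (siteSpin n x α * siteSpin n y α) (Equiv.arrowCongr π.symm (Equiv.refl (Fin (n + 1))))
  rw [heisAnisoGroundCorr_of_neZero, heisAnisoGroundCorr_of_neZero, ← hH, ← hO]
  exact congrArg Complex.re key

/-- **The direction-resolved bond correlations of the relabelled model**:
`εᵢ(K∘s) = ε_{s i}(K)`. [cite: KLS1988JSP, p. 1026] -/
theorem heisAnisoDirBondCorr_comp_perm (hL3 : 3 ≤ L) (K : Fin d → ℝ) (s : Equiv.Perm (Fin d))
    (α : Fin 3) (i : Fin d) :
    heisAnisoDirBondCorr α L n (K ∘ s) i = heisAnisoDirBondCorr α L n K (s i) := by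
  have hsi : s.symm (s i) = i := Equiv.symm_apply_apply s i
  -- (no `congr`: never let the kernel compare two different correlation sums by `rfl`)
  have hsum : ∑ x : TorusSite d L, heisAnisoGroundCorr α L n (K ∘ s) x (x + Pi.single i 1) =
      ∑ z : TorusSite d L, heisAnisoGroundCorr α L n K z (z + Pi.single (s i) 1) :=
    calc ∑ x : TorusSite d L, heisAnisoGroundCorr α L n (K ∘ s) x (x + Pi.single i 1)
        = ∑ z : TorusSite d L, heisAnisoGroundCorr α L n (K ∘ s) (z ∘ s)
            ((z ∘ s : TorusSite d L) + Pi.single i 1) :=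
          ((Equiv.arrowCongr s.symm (Equiv.refl (ZMod L))).sum_comp
            (fun x => heisAnisoGroundCorr α L n (K ∘ s) x (x + Pi.single i 1))).symm
      _ = ∑ z : TorusSite d L, heisAnisoGroundCorr α L n K z (z + Pi.single (s i) 1) :=
          sum_congr rfl fun z _ => by
            rw [← heisAnisoGroundCorr_comp_perm L n hL3 K s α z (z + Pi.single (s i) 1),
              add_single_comp_perm, hsi]
  rw [heisAnisoDirBondCorr_of_neZero, heisAnisoDirBondCorr_of_neZero, hsum]

/-- **(S) Equal couplings give equal bond correlations**: if `K` is invariant under the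
permutation `s` of the axes then `ε_{s i} = εᵢ`; in particular `K_a = K_b ⇒ ε_a = ε_b`
([KLS1988JSP] p. 1024: "The two cases of `i = 1` or `2` give the same result because of the
invariance under rotations of the lattice by `π/2`"). [cite: KLS1988JSP, pp. 1024, 1026] -/
theorem heisAnisoDirBondCorr_eq_of_coupling_eq (hL3 : 3 ≤ L) (K : Fin d → ℝ) (α : Fin 3)
    {a b : Fin d} (hab : K a = K b) :
    heisAnisoDirBondCorr α L n K a = heisAnisoDirBondCorr α L n K b := by
  have hK : K ∘ Equiv.swap a b = K := by
    ext i
    simp only [Function.comp_apply]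
    rcases eq_or_ne i a with rfl | hia
    · rw [Equiv.swap_apply_left, hab]
    · rcases eq_or_ne i b with rfl | hib
      · rw [Equiv.swap_apply_right, hab]
      · rw [Equiv.swap_apply_of_ne_of_ne hia hib]
  have h := heisAnisoDirBondCorr_comp_perm L n hL3 K (Equiv.swap a b) α a
  rw [hK, Equiv.swap_apply_left] at h
  exact h

/-- **(X) The axis-exchange inequality** ([KLS1988JSP] p. 1026, "rotate the lattice … the energy
would then be `-ρ₁ - rρ₁ - ρ₃`, which cannot be less than `-e'₀ = -2ρ₁ - rρ₃`. Thus, `ρ₃ ≤ ρ₁`"):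
for any two axes `a, b`, `(K_a - K_b)(ε_a - ε_b) ≤ 0` — the more strongly coupled direction has
the more negative bond correlation. Proof as printed: the ground state of the relabelled model
`H_{K∘(ab)}` is a trial state for `H_K` (`groundEnergy_le_groundStateFunctional_re`), its energy is
`3|Λ| Σᵢ Kᵢ ε_{(ab) i}` and `E₀(H_K) = 3|Λ| Σᵢ Kᵢ εᵢ`. [cite: KLS1988JSP, p. 1026] -/
theorem sub_mul_sub_dirBondCorr_nonpos (hL3 : 3 ≤ L) (K : Fin d → ℝ) (a b : Fin d) :
    (K a - K b) * (heisAnisoDirBondCorr 0 L n K a - heisAnisoDirBondCorr 0 L n K b) ≤ 0 := by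
  rcases eq_or_ne a b with rfl | hab
  · simp
  have hLd : (0 : ℝ) < (L : ℝ) ^ d := by
    have : (0 : ℝ) < L := by exact_mod_cast Nat.pos_of_ne_zero (NeZero.ne L)
    positivity
  set s := Equiv.swap a b with hs
  -- the variational comparison `E₀(H_K) ≤ ω_{K∘s}(H_K)`
  have hvar := groundEnergy_le_groundStateFunctional_re (heisAnisoTorus_isHermitian L n (K ∘ s))
    (heisAnisoTorus_isHermitian L n K)
  rw [groundEnergy_heisAnisoTorus_eq L n K hL3, re_groundStateFunctional_heisAnisoTorus L n K hL3 (K ∘ s)]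
    at hvar
  simp_rw [heisAnisoDirBondCorr_comp_perm L n hL3 K s 0] at hvar
  -- `Σᵢ Kᵢ εᵢ ≤ Σᵢ Kᵢ ε_{s i}`; the two sums differ only in the terms `i = a, b`
  have hsum : ∑ i, K i * heisAnisoDirBondCorr 0 L n K i ≤
      ∑ i, K i * heisAnisoDirBondCorr 0 L n K (s i) :=
    le_of_mul_le_mul_left (by linarith) (by positivity : (0 : ℝ) < 3 * (L : ℝ) ^ d)
  have hsplit : ∀ f : Fin d → ℝ, ∑ i, f i = f a + f b + ∑ i ∈ (univ.erase a).erase b, f i := by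
    intro f
    rw [← add_sum_erase _ _ (mem_univ a), ← add_sum_erase _ _ (mem_erase.2 ⟨hab.symm, mem_univ b⟩),
      add_assoc]
  have hrest : ∑ i ∈ (univ.erase a).erase b, K i * heisAnisoDirBondCorr 0 L n K (s i) =
      ∑ i ∈ (univ.erase a).erase b, K i * heisAnisoDirBondCorr 0 L n K i := by
    refine sum_congr rfl fun i hi => ?_
    obtain ⟨hib, hia⟩ := mem_erase.1 hi
    rw [hs, Equiv.swap_apply_of_ne_of_ne (mem_erase.1 hia).1 hib]
  rw [hsplit, hsplit (fun i => K i * heisAnisoDirBondCorr 0 L n K (s i)), hrest, hs,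
    Equiv.swap_apply_left, Equiv.swap_apply_right] at hsum
  nlinarith [hsum]

/-- **The largest coupling has the most negative bond correlation**: `K_b ≤ K_a ⇒ ε_a ≤ ε_b`
((X) for `K_b < K_a`, (S) for `K_b = K_a`). For `K = (1, 1, r)`, `r ≤ 1`, this is KLS's
"`ρ₃ ≤ ρ₁`". [cite: KLS1988JSP, p. 1026] -/
theorem heisAnisoDirBondCorr_le_of_coupling_le (hL3 : 3 ≤ L) (K : Fin d → ℝ) {a b : Fin d}
    (hba : K b ≤ K a) :
    heisAnisoDirBondCorr 0 L n K a ≤ heisAnisoDirBondCorr 0 L n K b := by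
  rcases hba.lt_or_eq with hlt | heq
  · have h := sub_mul_sub_dirBondCorr_nonpos L n hL3 K a b
    have hpos : 0 < K a - K b := sub_pos.2 hlt
    nlinarith [h, hpos]
  · exact (heisAnisoDirBondCorr_eq_of_coupling_eq L n hL3 K 0 heq.symm).le

end AxisPermutation

/-! ### (P): `Kᵢ εᵢ ≤ 0` by the plane flips -/

section PlaneFlip

variable (k : ℕ) [NeZero (2 * k)] (n : ℕ)

omit [NeZero (2 * k)] in
/-- The parity of the `i`-th coordinate of a site of the even torus (which side of the
"hyperplane flip" the site is on). [cite: KLS1988JSP, p. 1026] -/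
def planeParity (i : Fin d) (x : TorusSite d (2 * k)) : ZMod 2 :=
  ZMod.castHom (dvd_mul_right 2 k) (ZMod 2) (x i)

omit [NeZero (2 * k)] in
/-- Crossing an `i`-bond changes the `i`-parity. [cite: KLS1988JSP, p. 1026] -/
theorem planeParity_add_single_self (i : Fin d) (x : TorusSite d (2 * k)) :
    planeParity k i (x + Pi.single i 1) = planeParity k i x + 1 := by
  simp [planeParity, Pi.add_apply, Pi.single_eq_same, map_add]

omit [NeZero (2 * k)] in
/-- Crossing a `j`-bond, `j ≠ i`, does not change the `i`-parity. [cite: KLS1988JSP, p. 1026] -/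
theorem planeParity_add_single_of_ne {i j : Fin d} (hij : i ≠ j) (x : TorusSite d (2 * k)) :
    planeParity k i (x + Pi.single j 1) = planeParity k i x := by
  simp [planeParity, Pi.add_apply, Pi.single_eq_of_ne hij]

/-- **The three rotations by `π` about the spin axes**: for each axis `a` there is a unitary `R_a`
with `R_a S^b R_a⁻¹ = ± S^b`, sign `+` iff `b = a` (products of the tree's quarter turns).
[Tasaki 2020 §2.1; KLS1988JSP eqs. (15)–(16) (the rotation by `π` about the 2 axis)]
[cite: KLS1988JSP, eqs. (15)–(16)] -/
theorem exists_piRotation (a : Fin 3) :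
    ∃ R : Matrix (Fin (n + 1)) (Fin (n + 1)) ℂ, R * Rᴴ = 1 ∧ Rᴴ * R = 1 ∧
      ∀ b : Fin 3, R * spinVec n b * Rᴴ = (if b = a then (1 : ℂ) else -1) • spinVec n b := by
  obtain ⟨V, hV, hV', hVz, hVx, hVy⟩ := exists_unitary_conj_spinZ_eq_spinX n
  obtain ⟨D, hD, hD', hDx, hDy, hDz⟩ := exists_unitary_conj_spinX_eq_neg_spinY n
  have hconj : ∀ (A B M : Matrix (Fin (n + 1)) (Fin (n + 1)) ℂ),
      A * B * M * (A * B)ᴴ = A * (B * M * Bᴴ) * Aᴴ := by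
    intro A B M
    rw [conjTranspose_mul]
    simp only [Matrix.mul_assoc]
  -- `R₂ = V²`: `X ↦ -X`, `Y ↦ Y`, `Z ↦ -Z`
  have hR₂ : V * V * (V * V)ᴴ = 1 := by
    rw [conjTranspose_mul, Matrix.mul_assoc, ← Matrix.mul_assoc V Vᴴ, hV, Matrix.one_mul, hV]
  have hR₂' : (V * V)ᴴ * (V * V) = 1 := by
    rw [conjTranspose_mul, Matrix.mul_assoc, ← Matrix.mul_assoc Vᴴ V, hV', Matrix.one_mul, hV']
  have hR₂x : V * V * spinX n * (V * V)ᴴ = -spinX n := by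
    rw [hconj, hVx, Matrix.mul_neg, Matrix.neg_mul, hVz]
  have hR₂y : V * V * spinY n * (V * V)ᴴ = spinY n := by rw [hconj, hVy, hVy]
  have hR₂z : V * V * SpinOperators.spinZ n * (V * V)ᴴ = -SpinOperators.spinZ n := by
    rw [hconj, hVz, hVx]
  -- `R₃ = D²`: `X ↦ -X`, `Y ↦ -Y`, `Z ↦ Z`
  have hR₃ : D * D * (D * D)ᴴ = 1 := by
    rw [conjTranspose_mul, Matrix.mul_assoc, ← Matrix.mul_assoc D Dᴴ, hD, Matrix.one_mul, hD]
  have hR₃' : (D * D)ᴴ * (D * D) = 1 := by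
    rw [conjTranspose_mul, Matrix.mul_assoc, ← Matrix.mul_assoc Dᴴ D, hD', Matrix.one_mul, hD']
  have hR₃x : D * D * spinX n * (D * D)ᴴ = -spinX n := by
    rw [hconj, hDx, Matrix.mul_neg, Matrix.neg_mul, hDy]
  have hR₃y : D * D * spinY n * (D * D)ᴴ = -spinY n := by rw [hconj, hDy, hDx]
  have hR₃z : D * D * SpinOperators.spinZ n * (D * D)ᴴ = SpinOperators.spinZ n := by
    rw [hconj, hDz, hDz]
  -- `R₁ = D² V²`: `X ↦ X`, `Y ↦ -Y`, `Z ↦ -Z`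
  have hR₁ : D * D * (V * V) * (D * D * (V * V))ᴴ = 1 := by
    rw [conjTranspose_mul, Matrix.mul_assoc, ← Matrix.mul_assoc (V * V) (V * V)ᴴ, hR₂,
      Matrix.one_mul, hR₃]
  have hR₁' : (D * D * (V * V))ᴴ * (D * D * (V * V)) = 1 := by
    rw [conjTranspose_mul, Matrix.mul_assoc, ← Matrix.mul_assoc (D * D)ᴴ, hR₃', Matrix.one_mul, hR₂']
  have hR₁x : D * D * (V * V) * spinX n * (D * D * (V * V))ᴴ = spinX n := by
    rw [hconj, hR₂x, Matrix.mul_neg, Matrix.neg_mul, hR₃x, neg_neg]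
  have hR₁y : D * D * (V * V) * spinY n * (D * D * (V * V))ᴴ = -spinY n := by
    rw [hconj, hR₂y, hR₃y]
  have hR₁z : D * D * (V * V) * SpinOperators.spinZ n * (D * D * (V * V))ᴴ = -SpinOperators.spinZ n := by
    rw [hconj, hR₂z, Matrix.mul_neg, Matrix.neg_mul, hR₃z]
  fin_cases a
  · refine ⟨D * D * (V * V), hR₁, hR₁', fun b => ?_⟩
    fin_cases b
    · simpa using hR₁x
    · simpa using hR₁y
    · simpa using hR₁z
  · refine ⟨V * V, hR₂, hR₂', fun b => ?_⟩
    fin_cases b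
    · simpa using hR₂x
    · simpa using hR₂y
    · simpa using hR₂z
  · refine ⟨D * D, hR₃, hR₃', fun b => ?_⟩
    fin_cases b
    · simpa using hR₃x
    · simpa using hR₃y
    · simpa using hR₃z

variable {Λ : Type*} [Fintype Λ] [DecidableEq Λ]

/-- Conjugating a bond term by a product unitary acting on each spin component by a scalar:
`W ½(S^bS^b + S^bS^b)(x,y) W⁻¹ = (f_x f_y) · ½(S^bS^b + S^bS^b)(x,y)`.
[cite: KLS1988JSP, eqs. (15)–(16)] -/
theorem productOp_conj_spinBond_of_smul {u : Λ → Matrix (Fin (n + 1)) (Fin (n + 1)) ℂ}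
    (hua : ∀ z, u z * (u z)ᴴ = 1) (hub : ∀ z, (u z)ᴴ * u z = 1) {b : Fin 3} {f : Λ → ℂ}
    (hf : ∀ z, u z * spinVec n b * (u z)ᴴ = f z • spinVec n b) (x y : Λ) :
    productOp u * spinBond n b x y * (productOp u)ᴴ = (f x * f y) • spinBond n b x y := by
  rw [productOp_conj_spinBond hua hub, hf, hf, onSite_smul', onSite_smul', smul_mul_smul_comm,
    smul_mul_smul_comm, mul_comm (f y) (f x), ← smul_add, smul_comm, spinBond]
  rfl

/-- **The plane flip on a bond**: for the product unitary `W` rotating the spins on the odd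
`i`-hyperplanes by `R` (`R S^b R⁻¹ = c_b S^b`, `c_b = ±1`) and a bond `{x, y}`:
if `x, y` have the same `i`-parity the bond term `S^b_xS^b_y` is invariant, otherwise it is
multiplied by `c_b`. [cite: KLS1988JSP, eqs. (15)–(16), p. 1026] -/
theorem planeFlip_conj_spinBond (i : Fin d) {R : Matrix (Fin (n + 1)) (Fin (n + 1)) ℂ}
    (hR : R * Rᴴ = 1) (hR' : Rᴴ * R = 1) {c : Fin 3 → ℂ}
    (hc : ∀ b, R * spinVec n b * Rᴴ = c b • spinVec n b) (hc1 : ∀ b, c b * c b = 1) (b : Fin 3)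
    (x y : TorusSite d (2 * k)) :
    productOp (fun z : TorusSite d (2 * k) => if planeParity k i z = 0 then 1 else R) *
        spinBond n b x y *
        (productOp (fun z : TorusSite d (2 * k) => if planeParity k i z = 0 then 1 else R))ᴴ =
      (if planeParity k i x = planeParity k i y then (1 : ℂ) else c b) • spinBond n b x y := by
  set u : TorusSite d (2 * k) → Matrix (Fin (n + 1)) (Fin (n + 1)) ℂ :=
    fun z => if planeParity k i z = 0 then 1 else R with hu
  have hua : ∀ z, u z * (u z)ᴴ = 1 := by
    intro z; simp only [hu]; split_ifs
    · rw [conjTranspose_one, Matrix.mul_one]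
    · exact hR
  have hub : ∀ z, (u z)ᴴ * u z = 1 := by
    intro z; simp only [hu]; split_ifs
    · rw [conjTranspose_one, Matrix.mul_one]
    · exact hR'
  set f : TorusSite d (2 * k) → ℂ := fun z => if planeParity k i z = 0 then 1 else c b with hf
  have hfz : ∀ z, u z * spinVec n b * (u z)ᴴ = f z • spinVec n b := by
    intro z; simp only [hu, hf]; split_ifs
    · rw [conjTranspose_one, Matrix.mul_one, Matrix.one_mul, one_smul]
    · exact hc b
  have hfxy : f x * f y = (if planeParity k i x = planeParity k i y then (1 : ℂ) else c b) := by
    have h01 : ∀ t : ZMod 2, t = 0 ∨ t = 1 := by decide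
    have h10 : (1 : ZMod 2) ≠ 0 := by decide
    have h01' : (0 : ZMod 2) ≠ 1 := by decide
    simp only [hf]
    rcases h01 (planeParity k i x) with hx | hx <;> rcases h01 (planeParity k i y) with hy | hy <;>
      simp [hx, hy, hc1 b, h10, h01']
  rw [productOp_conj_spinBond_of_smul n hua hub hfz, hfxy]

/-- **The plane flip on the exchange terms**: `W (𝐒_x·𝐒_y) W⁻¹ = 𝐒_x·𝐒_y` for a bond inside an
`i`-parity class, and `= Σ_b c_b S^b_xS^b_y` across. [cite: KLS1988JSP, p. 1026] -/
theorem planeFlip_conj_spinDot (i : Fin d) {R : Matrix (Fin (n + 1)) (Fin (n + 1)) ℂ}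
    (hR : R * Rᴴ = 1) (hR' : Rᴴ * R = 1) {c : Fin 3 → ℂ}
    (hc : ∀ b, R * spinVec n b * Rᴴ = c b • spinVec n b) (hc1 : ∀ b, c b * c b = 1)
    (x y : TorusSite d (2 * k)) :
    productOp (fun z : TorusSite d (2 * k) => if planeParity k i z = 0 then 1 else R) *
        spinDot n x y *
        (productOp (fun z : TorusSite d (2 * k) => if planeParity k i z = 0 then 1 else R))ᴴ =
      ∑ b : Fin 3, (if planeParity k i x = planeParity k i y then (1 : ℂ) else c b) • spinBond n b x y := by
  rw [spinDot, Finset.mul_sum, Finset.sum_mul]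
  exact sum_congr rfl fun b _ => planeFlip_conj_spinBond k n i hR hR' hc hc1 b x y

/-- The coupling vector with the `i`-th coupling switched off, `K^{(i)} = (K₁, …, 0, …, K_d)`
([KLS1988JSP] p. 1026: the Hamiltonian "`H¹ + H²`" without the bonds of the third direction).
[cite: KLS1988JSP, p. 1026] -/
def couplingOff (K : Fin d → ℝ) (i : Fin d) : Fin d → ℝ := Function.update K i 0

/-- **The plane-flip average**: with the three `π`-rotations `W_a` on the odd `i`-hyperplanes,
`H_K + Σ_a W_a H_K W_a⁻¹ = 4 H_{K^{(i)}}` (every `j`-bond, `j ≠ i`, is fixed by each `W_a`; on an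
`i`-bond `Σ_a W_a (𝐒_x·𝐒_y) W_a⁻¹ = Σ_b (Σ_a c^a_b) S^bS^b = -𝐒_x·𝐒_y`). (`2k ≥ 3`.)
[cite: KLS1988JSP, p. 1026] -/
theorem heisAnisoTorus_add_sum_planeFlip (hL3 : 3 ≤ 2 * k) (K : Fin d → ℝ) (i : Fin d)
    (R : Fin 3 → Matrix (Fin (n + 1)) (Fin (n + 1)) ℂ) (hR : ∀ a, R a * (R a)ᴴ = 1)
    (hR' : ∀ a, (R a)ᴴ * R a = 1)
    (hc : ∀ a b, R a * spinVec n b * (R a)ᴴ = (if b = a then (1 : ℂ) else -1) • spinVec n b) :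
    heisAnisoTorus (2 * k) n K +
        ∑ a : Fin 3,
          productOp (fun z : TorusSite d (2 * k) => if planeParity k i z = 0 then 1 else R a) *
            heisAnisoTorus (2 * k) n K *
            (productOp (fun z : TorusSite d (2 * k) => if planeParity k i z = 0 then 1 else R a))ᴴ =
      (4 : ℂ) • heisAnisoTorus (2 * k) n (couplingOff K i) := by
  have hc1 : ∀ a b : Fin 3,
      (if b = a then (1 : ℂ) else -1) * (if b = a then (1 : ℂ) else -1) = 1 := by
    intro a b; split_ifs <;> norm_num
  -- the sum of the three sign patterns
  have hsign : ∀ b : Fin 3, ∑ a : Fin 3, (if b = a then (1 : ℂ) else -1) = -1 := by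
    intro b
    have h : ∀ a : Fin 3, (if b = a then (1 : ℂ) else -1) = (if b = a then (2 : ℂ) else 0) - 1 := by
      intro a; split_ifs <;> norm_num
    simp_rw [h, sum_sub_distrib, sum_ite_eq, if_pos (mem_univ _), sum_const, card_univ,
      Fintype.card_fin]
    norm_num
  -- bonds in the other directions are fixed by each flip
  have hfix : ∀ (a : Fin 3) (x : TorusSite d (2 * k)) (j : Fin d), j ≠ i →
      productOp (fun z : TorusSite d (2 * k) => if planeParity k i z = 0 then 1 else R a) *
          spinDot n x (x + Pi.single j 1) *
          (productOp (fun z : TorusSite d (2 * k) => if planeParity k i z = 0 then 1 else R a))ᴴ =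
        spinDot n x (x + Pi.single j 1) := by
    intro a x j hji
    rw [planeFlip_conj_spinDot k n i (hR a) (hR' a) (hc a) (hc1 a), spinDot]
    refine sum_congr rfl fun b _ => ?_
    rw [planeParity_add_single_of_ne k (Ne.symm hji), if_pos rfl, one_smul]
  -- the `i`-bonds: the three flips sum to `-𝐒_x·𝐒_y`
  have hflip : ∀ x : TorusSite d (2 * k),
      ∑ a : Fin 3, productOp (fun z : TorusSite d (2 * k) => if planeParity k i z = 0 then 1 else R a) *
          spinDot n x (x + Pi.single i 1) *
          (productOp (fun z : TorusSite d (2 * k) => if planeParity k i z = 0 then 1 else R a))ᴴ =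
        -spinDot n x (x + Pi.single i 1) := by
    intro x
    have hne : planeParity k i x ≠ planeParity k i (x + Pi.single i 1) := by
      rw [planeParity_add_single_self]
      intro h
      have h2 := congrArg (fun t => t - planeParity k i x) h
      simp only [sub_self, add_sub_cancel_left] at h2
      exact zero_ne_one h2
    calc ∑ a : Fin 3, productOp (fun z : TorusSite d (2 * k) => if planeParity k i z = 0 then 1 else R a) *
          spinDot n x (x + Pi.single i 1) *
          (productOp (fun z : TorusSite d (2 * k) => if planeParity k i z = 0 then 1 else R a))ᴴ
        = ∑ a : Fin 3, ∑ b : Fin 3, (if b = a then (1 : ℂ) else -1) •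
            spinBond n b x (x + Pi.single i 1) := by
          refine sum_congr rfl fun a _ => ?_
          rw [planeFlip_conj_spinDot k n i (hR a) (hR' a) (hc a) (hc1 a)]
          refine sum_congr rfl fun b _ => ?_
          rw [if_neg hne]
      _ = ∑ b : Fin 3, (∑ a : Fin 3, (if b = a then (1 : ℂ) else -1)) •
            spinBond n b x (x + Pi.single i 1) := by
          rw [Finset.sum_comm]
          exact sum_congr rfl fun b _ => (Finset.sum_smul).symm
      _ = -spinDot n x (x + Pi.single i 1) := by
          rw [spinDot, ← sum_neg_distrib]
          exact sum_congr rfl fun b _ => by rw [hsign b, neg_one_smul]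
  -- distribute the conjugations over the site/direction sum
  have hdist : ∀ a : Fin 3,
      productOp (fun z : TorusSite d (2 * k) => if planeParity k i z = 0 then 1 else R a) *
          (∑ x : TorusSite d (2 * k), ∑ j : Fin d, ((K j : ℝ) : ℂ) • spinDot n x (x + Pi.single j 1)) *
          (productOp (fun z : TorusSite d (2 * k) => if planeParity k i z = 0 then 1 else R a))ᴴ =
        ∑ x : TorusSite d (2 * k), ∑ j : Fin d, ((K j : ℝ) : ℂ) •
          (productOp (fun z : TorusSite d (2 * k) => if planeParity k i z = 0 then 1 else R a) *
            spinDot n x (x + Pi.single j 1) *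
            (productOp (fun z : TorusSite d (2 * k) => if planeParity k i z = 0 then 1 else R a))ᴴ) := by
    intro a
    rw [Finset.mul_sum, Finset.sum_mul]
    refine sum_congr rfl fun x _ => ?_
    rw [Finset.mul_sum, Finset.sum_mul]
    refine sum_congr rfl fun j _ => ?_
    rw [Matrix.mul_smul, Matrix.smul_mul]
  -- reorder the second summand as `Σ_x Σ_j K_j • Σ_a W_a (𝐒_x·𝐒_{x+e_j}) W_a⁻¹`
  have h2 : ∑ a : Fin 3,
      productOp (fun z : TorusSite d (2 * k) => if planeParity k i z = 0 then 1 else R a) *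
          heisAnisoTorus (2 * k) n K *
          (productOp (fun z : TorusSite d (2 * k) => if planeParity k i z = 0 then 1 else R a))ᴴ =
      ∑ x : TorusSite d (2 * k), ∑ j : Fin d, ((K j : ℝ) : ℂ) • ∑ a : Fin 3,
        (productOp (fun z : TorusSite d (2 * k) => if planeParity k i z = 0 then 1 else R a) *
          spinDot n x (x + Pi.single j 1) *
          (productOp (fun z : TorusSite d (2 * k) => if planeParity k i z = 0 then 1 else R a))ᴴ) := by
    rw [heisAnisoTorus_eq_sum (2 * k) n hL3 K]
    simp_rw [hdist]
    rw [Finset.sum_comm]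
    refine sum_congr rfl fun x _ => ?_
    rw [Finset.sum_comm]
    refine sum_congr rfl fun j _ => ?_
    rw [← smul_sum]
  rw [h2, heisAnisoTorus_eq_sum (2 * k) n hL3 K, heisAnisoTorus_eq_sum (2 * k) n hL3 (couplingOff K i),
    ← sum_add_distrib, smul_sum]
  refine sum_congr rfl fun x _ => ?_
  rw [← sum_add_distrib, smul_sum]
  refine sum_congr rfl fun j _ => ?_
  by_cases hji : j = i
  · subst hji
    rw [hflip x, couplingOff, Function.update_self, smul_neg, add_neg_cancel, Complex.ofReal_zero,
      zero_smul, smul_zero]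
  · rw [sum_congr rfl fun a _ => hfix a x j hji, sum_const, card_univ, Fintype.card_fin, couplingOff,
      Function.update_of_ne hji]
    module

end PlaneFlip


/-! ### (P): the sign of the bond correlations -/

section Sign

variable (k : ℕ) [NeZero (2 * k)] (n : ℕ)

/-- Superadditivity over a finite family: `E₀(A) + Σᵢ E₀(Bᵢ) ≤ E₀(A + Σᵢ Bᵢ)`.
[cite: KLS1988JSP, p. 1026] -/
theorem Matrix.groundEnergy_add_sum_groundEnergy_le {m ι : Type*} [Fintype m] [DecidableEq m]
    [Nonempty m] [DecidableEq ι] (s : Finset ι) {A : Matrix m m ℂ} (hA : A.IsHermitian)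
    {B : ι → Matrix m m ℂ} (hB : ∀ i, (B i).IsHermitian) :
    A.groundEnergy + ∑ i ∈ s, (B i).groundEnergy ≤ (A + ∑ i ∈ s, B i).groundEnergy := by
  induction s using Finset.induction_on with
  | empty => simp
  | @insert j s hj ih =>
    have hsum : (A + ∑ i ∈ s, B i).IsHermitian :=
      hA.add ((isSelfAdjoint_sum s fun i _ => (hB i).isSelfAdjoint).isHermitian)
    rw [sum_insert hj, sum_insert hj, show A + (B j + ∑ i ∈ s, B i) = (A + ∑ i ∈ s, B i) + B j by abel]
    have h := Matrix.groundEnergy_add_groundEnergy_le hsum (hB j)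
    linarith

/-- **Switching off a coupling raises the ground-state energy**: `E₀(H_K) ≤ E₀(H_{K^{(i)}})`
(`2k ≥ 4`). This is the content of KLS's "`ρ₃ ≥ 0`" argument (p. 1026, with the planar product
ground state as the trial state of `H`); here by the plane-flip average
`H_K + Σ_a W_a H_K W_a⁻¹ = 4H_{K^{(i)}}` with superadditivity and unitary invariance of `E₀`.
[cite: KLS1988JSP, p. 1026] -/
theorem heisAnisoTorus_groundEnergy_le_couplingOff (hL3 : 3 ≤ 2 * k) (K : Fin d → ℝ) (i : Fin d) :
    (heisAnisoTorus (2 * k) n K).groundEnergy ≤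
      (heisAnisoTorus (2 * k) n (couplingOff K i)).groundEnergy := by
  have hex := fun a : Fin 3 => exists_piRotation n a
  choose R hR hR' hc using hex
  set W : Fin 3 → Op (TorusSite d (2 * k)) (n + 1) := fun a =>
    productOp (fun z : TorusSite d (2 * k) => if planeParity k i z = 0 then 1 else R a) with hW
  have hWu : ∀ a, W a * (W a)ᴴ = 1 := by
    intro a
    simp only [hW]
    refine productOp_mul_conjTranspose fun z => ?_
    split_ifs
    · rw [conjTranspose_one, Matrix.mul_one]
    · exact hR a
  have hWmem : ∀ a, W a ∈ Matrix.unitaryGroup (TensorIndex (TorusSite d (2 * k)) (n + 1)) ℂ :=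
    fun a => Matrix.mem_unitaryGroup_iff.2 (hWu a)
  set H := heisAnisoTorus (2 * k) n K with hH
  have hHh : H.IsHermitian := heisAnisoTorus_isHermitian (2 * k) n K
  have hH' : (heisAnisoTorus (2 * k) n (couplingOff K i)).IsHermitian :=
    heisAnisoTorus_isHermitian (2 * k) n _
  have hconjH : ∀ a, (W a * H * (W a)ᴴ).IsHermitian := fun a =>
    isHermitian_mul_mul_conjTranspose _ hHh
  have havg : H + ∑ a : Fin 3, W a * H * (W a)ᴴ = (4 : ℂ) • heisAnisoTorus (2 * k) n (couplingOff K i) := by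
    simp only [hW, hH]
    exact heisAnisoTorus_add_sum_planeFlip k n hL3 K i R hR hR' hc
  haveI : Nonempty (TensorIndex (TorusSite d (2 * k)) (n + 1)) := ⟨fun _ => 0⟩
  have hsup := Matrix.groundEnergy_add_sum_groundEnergy_le (univ : Finset (Fin 3)) hHh hconjH
  rw [havg, show (4 : ℂ) = ((4 : ℝ) : ℂ) by norm_num, groundEnergy_smul_of_pos hH' (by norm_num),
    sum_congr rfl fun a _ => Matrix.groundEnergy_unitary_conj (hWmem a), sum_const, card_univ,
    Fintype.card_fin] at hsup
  simp only [nsmul_eq_mul, Nat.cast_ofNat] at hsup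
  linarith

/-- **(P) The bond correlations of the antiferromagnet have the antiferromagnetic sign**:
`Kᵢ εᵢ ≤ 0` for every direction `i` — KLS's "`ρ₃ ≥ 0`" (p. 1026) for the model (5), every spin,
every `K`, on the even torus of side `2k ≥ 4`: `E₀(H_K) ≤ E₀(H_{K^{(i)}}) ≤ ω_K(H_{K^{(i)}})
= E₀(H_K) - 3|Λ| Kᵢ εᵢ`. [cite: KLS1988JSP, p. 1026] -/
theorem mul_heisAnisoDirBondCorr_nonpos (hL3 : 3 ≤ 2 * k) (K : Fin d → ℝ) (i : Fin d) :
    K i * heisAnisoDirBondCorr 0 (2 * k) n K i ≤ 0 := by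
  haveI : Nonempty (TensorIndex (TorusSite d (2 * k)) (n + 1)) := ⟨fun _ => 0⟩
  have hLd : (0 : ℝ) < (((2 * k : ℕ) : ℝ)) ^ d := by
    have : (0 : ℝ) < ((2 * k : ℕ) : ℝ) := by exact_mod_cast (show 0 < 2 * k by omega)
    positivity
  have h1 := heisAnisoTorus_groundEnergy_le_couplingOff k n hL3 K i
  have h2 := groundEnergy_le_groundStateFunctional_re (heisAnisoTorus_isHermitian (2 * k) n K)
    (heisAnisoTorus_isHermitian (2 * k) n (couplingOff K i))
  rw [re_groundStateFunctional_heisAnisoTorus (2 * k) n (couplingOff K i) hL3 K] at h2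
  rw [groundEnergy_heisAnisoTorus_eq (2 * k) n K hL3] at h1
  have hoff : ∀ j, couplingOff K i j * heisAnisoDirBondCorr 0 (2 * k) n K j =
      K j * heisAnisoDirBondCorr 0 (2 * k) n K j -
        if j = i then K j * heisAnisoDirBondCorr 0 (2 * k) n K j else 0 := by
    intro j
    by_cases hji : j = i
    · subst hji; simp [couplingOff]
    · simp [couplingOff, hji]
  simp_rw [hoff, sum_sub_distrib, sum_ite_eq', if_pos (mem_univ _)] at h2
  have h3 : 3 * (((2 * k : ℕ) : ℝ)) ^ d * (K i * heisAnisoDirBondCorr 0 (2 * k) n K i) ≤ 0 := by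
    linarith
  exact nonpos_of_mul_nonpos_right h3 (by positivity)

/-- **(P), divided**: `εᵢ ≤ 0` in every direction with `Kᵢ > 0` ("`ρ₃ ≥ 0`").
[cite: KLS1988JSP, p. 1026] -/
theorem heisAnisoDirBondCorr_nonpos (hL3 : 3 ≤ 2 * k) {K : Fin d → ℝ} {i : Fin d} (hKi : 0 < K i) :
    heisAnisoDirBondCorr 0 (2 * k) n K i ≤ 0 :=
  nonpos_of_mul_nonpos_right (mul_heisAnisoDirBondCorr_nonpos k n hL3 K i) hKi

end Sign

/-! ### (N): the Néel state as a trial state -/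

section NeelBound

variable (k : ℕ) [NeZero (2 * k)] (n : ℕ)

/-- **(N) The Néel variational bound for direction-dependent couplings**: on the even torus of side
`2k ≥ 4`, `Σᵢ Kᵢ εᵢ ≤ -(S²/3) Σᵢ Kᵢ` — the Néel basis state has energy `-S² Kᵢ` on every `i`-bond,
so `E₀(H_K) = 3|Λ| Σᵢ Kᵢ εᵢ ≤ -S² |Λ| Σᵢ Kᵢ` ([KLS1988JSP] p. 1023: "`e₀` ranging from the Néel
bound of `(2+r)/4`"; [DysonLiebSimon1978] App. C). [cite: KLS1988JSP, p. 1023] -/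
theorem sum_mul_heisAnisoDirBondCorr_le_neel (hL3 : 3 ≤ 2 * k) (K : Fin d → ℝ) :
    ∑ i, K i * heisAnisoDirBondCorr 0 (2 * k) n K i ≤ -(((n : ℝ) / 2) ^ 2 / 3) * ∑ i, K i := by
  set L := 2 * k with hLdef
  have hLd : (0 : ℝ) < ((L : ℕ) : ℝ) ^ d := by
    have : (0 : ℝ) < ((L : ℕ) : ℝ) := by exact_mod_cast (show 0 < L by omega)
    positivity
  have hcard : (Fintype.card (TorusSite d L) : ℂ) = ((L : ℕ) : ℂ) ^ d := by
    rw [Fintype.card_pi, prod_const, ZMod.card, card_univ, Fintype.card_fin]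
    push_cast
    ring
  set H := heisAnisoTorus L n K with hH
  have hHerm : H.IsHermitian := heisAnisoTorus_isHermitian L n K
  -- (1) the ground energy through the bond correlations
  have h1 : H.groundEnergy = 3 * ((L : ℕ) : ℝ) ^ d * ∑ i, K i * heisAnisoDirBondCorr 0 L n K i :=
    groundEnergy_heisAnisoTorus_eq L n K hL3
  -- (2) the Néel configuration and its energy
  set ε : TorusSite d L → ZMod 2 := fun x =>
    ∑ j, ZMod.castHom (dvd_mul_right 2 k) (ZMod 2) (x j) with hε
  set σN : TensorIndex (TorusSite d L) (n + 1) := fun x => if ε x = 0 then 0 else Fin.last n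
    with hσN
  have h01 : ∀ t : ZMod 2, t = 0 ∨ t = 1 := by decide
  have key : ∀ (x' : TorusSite d L) (i : Fin d),
      (σN x' = 0 ∧ σN (x' + Pi.single i 1) = Fin.last n ∨
        σN x' = Fin.last n ∧ σN (x' + Pi.single i 1) = 0) := by
    intro x' i
    have hpar : ε (x' + Pi.single i 1) = ε x' + 1 := torusParity_add_single k x' i
    simp only [hσN, hpar]
    rcases h01 (ε x') with h0 | h1'
    · left
      rw [if_pos h0, if_neg (by rw [h0]; decide)]
      exact ⟨rfl, rfl⟩
    · right
      rw [if_neg (by rw [h1']; decide), if_pos (by rw [h1']; decide)]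
      exact ⟨rfl, rfl⟩
  have h2 : H σN σN = -((((n : ℂ) / 2) ^ 2) * ((L : ℕ) : ℂ) ^ d * ∑ i, ((K i : ℝ) : ℂ)) := by
    rw [hH, heisAnisoTorus_eq_sum L n hL3 K, Matrix.sum_apply]
    simp_rw [Matrix.sum_apply, Matrix.smul_apply, smul_eq_mul]
    have hne : ∀ (x : TorusSite d L) (i : Fin d), x ≠ x + Pi.single i 1 := fun x i h => by
      have hpar := torusParity_add_single k x i
      rw [← h] at hpar
      exact absurd (add_left_cancel ((add_zero _).trans hpar)) (by decide)
    have hx : ∀ (x : TorusSite d L) (i : Fin d),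
        ((K i : ℝ) : ℂ) * spinDot n x (x + Pi.single i 1) σN σN =
          ((K i : ℝ) : ℂ) * (-(((n : ℂ) / 2) ^ 2)) := by
      intro x i
      rw [spinDot_apply_neel n (hne x i) σN (key x i)]
    simp_rw [hx]
    rw [sum_const, card_univ, nsmul_eq_mul, hcard, ← sum_mul]
    ring
  -- (3) the variational principle
  set v : TensorIndex (TorusSite d L) (n + 1) → ℂ := Pi.single σN 1 with hv
  have hstar : star v = v := by rw [hv, ← Pi.single_star, star_one]
  have hψ : star v ⬝ᵥ v = 1 := by
    rw [hstar, hv, single_dotProduct, Pi.single_eq_same, one_mul]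
  have h3 := groundEnergy_le_rayleigh_holds hHerm v hψ
  rw [h1, hstar, hv, single_dotProduct, one_mul, mulVec_single_one, Matrix.col_apply, h2,
    Complex.neg_re, show (((n : ℂ) / 2) ^ 2 * ((L : ℕ) : ℂ) ^ d * ∑ i, ((K i : ℝ) : ℂ)) =
      ((((n : ℝ) / 2) ^ 2 * ((L : ℕ) : ℝ) ^ d * ∑ i, K i : ℝ) : ℂ) by push_cast; ring,
    Complex.ofReal_re] at h3
  -- divide by `3 L^d`
  have h4 : ((L : ℕ) : ℝ) ^ d * (3 * ∑ i, K i * heisAnisoDirBondCorr 0 L n K i) ≤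
      ((L : ℕ) : ℝ) ^ d * (-(((n : ℝ) / 2) ^ 2) * ∑ i, K i) := by linarith
  have h5 := le_of_mul_le_mul_left h4 hLd
  linarith

end NeelBound

/-! ### Packaging for the infrared bound: the direction of a largest coupling -/

section MaxCoupling

variable (k : ℕ) [NeZero (2 * k)] (n : ℕ)

/-- **`-εᵢ ≤ -ε_{i₀}` for a direction `i₀` of a largest coupling** (all `i`): KLS's
"`0 ≤ ρ₃ ≤ ρ₁`" ⇒ "the double commutator is bounded above by …`ρ₁`…". [cite: KLS1988JSP, p. 1026] -/
theorem neg_heisAnisoDirBondCorr_le_of_isMax (hL3 : 3 ≤ 2 * k) (K : Fin d → ℝ) {i₀ : Fin d}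
    (hmax : ∀ i, K i ≤ K i₀) (i : Fin d) :
    -heisAnisoDirBondCorr 0 (2 * k) n K i ≤ -heisAnisoDirBondCorr 0 (2 * k) n K i₀ :=
  neg_le_neg (heisAnisoDirBondCorr_le_of_coupling_le (2 * k) n hL3 K (hmax i))

/-- **The infrared bound with the largest-coupling correlation** (KLS (6)–(7) for the model (5)
before the last step `ρ₁ ≤ e₀/2`): for `K > 0` with a largest coupling in direction `i₀`, on the even
torus of side `2k ≥ 4` and for every `q ≠ Q`,
`0 ≤ ĝ_q` and `ĝ_q² E^K_{q-Q} ≤ ½(-ε_{i₀}) E^K_q`. [cite: KLS1988JSP, eqs. (6)–(7), p. 1026] -/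
theorem heisAniso_infraredBound_max (hk : 2 ≤ k) {K : Fin d → ℝ} (hK : ∀ i, 0 < K i) {i₀ : Fin d}
    (hmax : ∀ i, K i ≤ K i₀) (q : TorusSite d (2 * k)) (hq : q ≠ neelIndex (2 * k)) :
    0 ≤ heisAnisoStructureFactor 0 (2 * k) n K q ∧
      heisAnisoStructureFactor 0 (2 * k) n K q ^ 2 *
          NVectorAniso.anisoDispersion K (latticeMomentum (2 * k) (q - neelIndex (2 * k))) ≤
        (-heisAnisoDirBondCorr 0 (2 * k) n K i₀ / 2) *
          NVectorAniso.anisoDispersion K (latticeMomentum (2 * k) q) := by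
  have hL3 : 3 ≤ 2 * k := by omega
  obtain ⟨h0, hIR⟩ := heisAniso_infraredBound_ground n k hk hK q hq
  refine ⟨h0, hIR.trans ?_⟩
  rw [NVectorAniso.anisoDispersion, mul_sum, mul_sum]
  refine sum_le_sum fun i _ => ?_
  have hi := neg_heisAnisoDirBondCorr_le_of_isMax k n hL3 K hmax i
  have hw : 0 ≤ K i * (1 - Real.cos (latticeMomentum (2 * k) q i)) :=
    mul_nonneg (hK i).le (sub_nonneg.2 (Real.cos_le_one _))
  nlinarith [mul_nonneg hw (sub_nonneg.2 hi)]

end MaxCoupling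

end Literature.MathematicalPhysics.QuantumLattice
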